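import Literature.AnabelianGeometry.EtaleTheta.Discharge.Sec1Thm16GKN
import Literature.AnabelianGeometry.EtaleTheta.Discharge.Sec1Thm16GKNKummer
import Mathlib.RingTheory.RootsOfUnity.PrimitiveRoots
import HarnessLib

/-!
# [EtTh] §1 p. 13: «G_{K_N} acts trivially on (Δ^tp_X)^ell / N·(Δ^tp_Y)^ell» FROM the Tate-module
# structure of `(Δ^tp_X)^ell` — the characterisation `GKNIsKernelOfAction D N` derived from the
# mod-`N` Tate twist of `(Δ^tp_Y)^ell` and the Kummer class of `q_X`

Mochizuki, *The étale theta function …*, Publ. RIMS **45** (2009), §1 p. 13: "`K_N := K(ζ_N, q_X^{1/N})`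
… `1 → (Δ^tp_Y)^ell ⊗ ℤ/Nℤ → Gal(Y_N/Y) → Gal(K_N/K) → 1` … [Indeed, this follows from the fact that
`G_{K_N}` acts trivially on `(Δ^tp_X)^ell/N·(Δ^tp_Y)^ell`.]"; p. 16 "`Δ^tp_Y/Δ^tp_{Y_N} ≅ ℤ/Nℤ(1)`"
[cite: MochizukiEtTh2009, §1 p.13].

abc-iut cell, layer L2, sub-DAG `plan/L2/SUBDAG-EtTh-Thm16.md` leaf L04 (seat abc-iut-w5-d051; L2-lead
03:24:22Z (a)). The root interface `ThetaSetting` carries `G_{K_N}` field-theoretically and the ell-quotient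
`(Π^tp_X)^ell` abstractly, with no axiom relating them; the printed bracket is therefore the named
statement `Thm16Sub.GKNIsKernelOfAction D N` (abc-iut-L6-d5, p418133), a hypothesis of the assembly of
Thm. 1.6 (i) (GAP-LEDGER G-w5d051-1). This proof-only file DERIVES it, for every `N`, from the printed
`G_K`-module structure of `(Δ^tp_X)^ell` modulo `N` stated as explicit binders (the conjuncts of the clause
`tate` drafted for abc-iut-L2-t6's origin predicate `ThetaSetting.IsThm16Origin`; none is asserted):
given `y₁ ∈ Δ^tp_Y`, `z ∈ Δ^tp_X` lifting `1 ∈ Z`, a primitive `N`-th root of unity `ζ` and an `N`-th root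
`r` of `q_X` such that
* (a) the class of `y₁` has order exactly `N` in `(Δ^tp_Y)^ell/N·(Δ^tp_Y)^ell`;
* (b) [Tate twist] `aug(g) ζ = ζ^k ⟹ (g y g⁻¹)^ell ≡ (y^ell)^k` for every `y ∈ Δ^tp_Y`;
* (c) [Kummer class of `q_X`] `aug(g) r = ζ^m·r ⟹ (g z g⁻¹ z⁻¹)^ell ≡ (y₁^ell)^m`,

**`Thm16Sub.gknIsKernelOfAction_of_tate`** : `GKNIsKernelOfAction D N`. Direction (→): `aug(g) ∈ G_{K_N}`
fixes `ζ` and `r` (abc-iut-w5-d051 `aug_mem_GKN_iff`, p419343), so (b) with `k = 1` and (c) with `m = 0`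
say that `g` commutes modulo `N·(Δ^tp_Y)^ell` with `Δ^tp_Y` and with `z`; the elements of `Δ^tp_X` with
this property form a subgroup (`(Δ^tp_X)^ell` is abelian: `toEll_commutator_eq_one_of_mem_delta`,
p419109) and `Δ^tp_X = Δ^tp_Y·⟨z⟩` (`Π^tp_Y = Ker(Π^tp_X ↠ Z)`). Direction (←): `aug(g) ζ = ζ^k` and
`aug(g) r = ζ^m r` for some `k, m`; commuting with `y₁` resp. `z` modulo `N` forces `N ∣ k − 1` resp.
`N ∣ m` by (a)–(c), i.e. `aug(g)` fixes `ζ` and `r`, hence all `N`-th roots of unity and of `q_X`. Also the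
bundled form `gknIsKernelOfAction_of_tateClause` taking the clause's existential conjunction verbatim.

HONEST FRAMING: [EtTh] is refereed and undisputed; the Tate-module binders are hypotheses (to be
inhabited at a model of the root), never asserted; typed ≠ proved; nothing here bears on [IUTchIII]
Cor. 3.12. Plain group theory + Kummer bookkeeping over Mathlib's `IsPrimitiveRoot`.
-/

noncomputable section

namespace Literature.AnabelianGeometry.EtaleTheta

open Literature.AnabelianGeometry.SemiGraphs

namespace Thm16Sub

variable {p : ℕ} [Fact p.Prime] (D : ThetaSetting p)

/-! ### `(Δ^tp_X)^ell` is abelian; conjugation preserves `N·(Δ^tp_Y)^ell` -/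

/-- Images of elements of `Δ^tp_X` commute in `(Π^tp_X)^ell` ("`Δ^ell_X = Δ^ab_X`", p. 12).
[cite: MochizukiEtTh2009, §1 p.12] -/
theorem toEll_comm_of_mem_delta {a b : D.PiTemp} (ha : a ∈ D.DeltaTemp) (hb : b ∈ D.DeltaTemp) :
    toEll D a * toEll D b = toEll D b * toEll D a := by
  have h := toEll_commutator_eq_one_of_mem_delta D ha hb
  rw [map_mul, map_mul, map_mul, map_inv, map_inv, mul_inv_eq_one, mul_inv_eq_iff_eq_mul] at h
  exact h

/-- `Δ^tp_Y` is normal in `Π^tp_X` (`= Ker(toZ) ∩ Ker(aug)`). [cite: MochizukiEtTh2009, §1 p.12] -/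
theorem conj_mem_DtpY (g : D.PiTemp) {y : D.PiTemp} (hy : y ∈ D.DtpY) : g * y * g⁻¹ ∈ D.DtpY := by
  refine ⟨?_, ?_⟩
  · change g * y * g⁻¹ ∈ D.toZ.ker
    have hy1 : y ∈ D.toZ.ker := hy.1
    exact (MonoidHom.normal_ker D.toZ).conj_mem y hy1 g
  · exact (deltaTemp_normal D).conj_mem y hy.2 g

/-- Conjugation by `g^ell` preserves `N·(Δ^tp_Y)^ell`. [cite: MochizukiEtTh2009, §1 p.13] -/
theorem conj_mem_ellPowersY (N : ℕ+) (g : D.PiTemp) {b : D.GtpEll} (hb : b ∈ ellPowersY D N) :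
    toEll D g * b * (toEll D g)⁻¹ ∈ ellPowersY D N := by
  have hb' : MulAut.conj (toEll D g) b ∈ (ellPowersY D N).map (MulAut.conj (toEll D g)).toMonoidHom :=
    ⟨b, hb, rfl⟩
  have hle : (ellPowersY D N).map (MulAut.conj (toEll D g)).toMonoidHom ≤ ellPowersY D N := by
    rw [ellPowersY, MonoidHom.map_closure]
    refine Subgroup.closure_mono ?_
    rintro _ ⟨_, ⟨_, ⟨y, hy, rfl⟩, rfl⟩, rfl⟩
    refine ⟨toEll D (g * y * g⁻¹), ⟨g * y * g⁻¹, conj_mem_DtpY D g hy, rfl⟩, ?_⟩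
    simp only [MulEquiv.coe_toMonoidHom, MulAut.conj_apply, map_pow, map_mul, map_inv]
  exact hle hb'

/-! ### The subgroup of elements commuting with `g` modulo `N·(Δ^tp_Y)^ell` -/

/-- For fixed `g`, the elements `x ∈ Δ^tp_X` with `(g x g⁻¹ x⁻¹)^ell ∈ N·(Δ^tp_Y)^ell` are closed under
products (because `(Δ^tp_X)^ell` is abelian). [cite: MochizukiEtTh2009, §1 p.13] -/
theorem actsTrivially_mul (N : ℕ+) (g : D.PiTemp) {x x' : D.PiTemp} (hx : x ∈ D.DeltaTemp)
    (hx' : x' ∈ D.DeltaTemp) (h : toEll D (g * x * g⁻¹ * x⁻¹) ∈ ellPowersY D N)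
    (h' : toEll D (g * x' * g⁻¹ * x'⁻¹) ∈ ellPowersY D N) :
    toEll D (g * (x * x') * g⁻¹ * (x * x')⁻¹) ∈ ellPowersY D N := by
  have e : g * (x * x') * g⁻¹ * (x * x')⁻¹ =
      (g * x * g⁻¹ * x⁻¹) * (x * (g * x' * g⁻¹ * x'⁻¹) * x⁻¹) := by group
  have hc : g * x' * g⁻¹ * x'⁻¹ ∈ D.DeltaTemp :=
    D.DeltaTemp.mul_mem ((deltaTemp_normal D).conj_mem x' hx' g) (D.DeltaTemp.inv_mem hx')
  have hcomm : toEll D x * toEll D (g * x' * g⁻¹ * x'⁻¹) * (toEll D x)⁻¹ =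
      toEll D (g * x' * g⁻¹ * x'⁻¹) := by
    rw [toEll_comm_of_mem_delta D hx hc, mul_inv_cancel_right]
  have e2 : toEll D (x * (g * x' * g⁻¹ * x'⁻¹) * x⁻¹) =
      toEll D x * toEll D (g * x' * g⁻¹ * x'⁻¹) * (toEll D x)⁻¹ := by
    rw [map_mul, map_mul, map_inv]
  rw [e, map_mul (toEll D) (g * x * g⁻¹ * x⁻¹), e2, hcomm]
  exact (ellPowersY D N).mul_mem h h'

/-- … and under inverses. [cite: MochizukiEtTh2009, §1 p.13] -/
theorem actsTrivially_inv (N : ℕ+) (g : D.PiTemp) {x : D.PiTemp} (hx : x ∈ D.DeltaTemp)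
    (h : toEll D (g * x * g⁻¹ * x⁻¹) ∈ ellPowersY D N) :
    toEll D (g * x⁻¹ * g⁻¹ * x⁻¹⁻¹) ∈ ellPowersY D N := by
  have e : g * x⁻¹ * g⁻¹ * x⁻¹⁻¹ = x⁻¹ * (g * x * g⁻¹ * x⁻¹)⁻¹ * x := by group
  have hc : g * x * g⁻¹ * x⁻¹ ∈ D.DeltaTemp :=
    D.DeltaTemp.mul_mem ((deltaTemp_normal D).conj_mem x hx g) (D.DeltaTemp.inv_mem hx)
  have hcomm : (toEll D x)⁻¹ * (toEll D (g * x * g⁻¹ * x⁻¹))⁻¹ * toEll D x =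
      (toEll D (g * x * g⁻¹ * x⁻¹))⁻¹ := by
    have hxc := toEll_comm_of_mem_delta D hx hc
    -- `x` and `c` commute, hence `x⁻¹ c⁻¹ x = c⁻¹`
    have : (toEll D x)⁻¹ * (toEll D (g * x * g⁻¹ * x⁻¹))⁻¹ =
        (toEll D (g * x * g⁻¹ * x⁻¹))⁻¹ * (toEll D x)⁻¹ := by
      rw [← mul_inv_rev, ← mul_inv_rev, hxc]
    rw [this, inv_mul_cancel_right]
  rw [e, map_mul, map_mul, map_inv, map_inv, hcomm]
  exact (ellPowersY D N).inv_mem h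

/-- `Δ^tp_X = Δ^tp_Y · ⟨z⟩` for any `z ∈ Δ^tp_X` with `toZ z = 1` (`Π^tp_Y = Ker(Π^tp_X ↠ Z)`): every
`x ∈ Δ^tp_X` is `y · z^n` with `y ∈ Δ^tp_Y`, `n = toZ x`. [cite: MochizukiEtTh2009, §1 p.12] -/
theorem exists_mem_DtpY_mul_zpow {z : D.PiTemp} (hz : z ∈ D.DeltaTemp)
    (hzZ : D.toZ z = Multiplicative.ofAdd 1) {x : D.PiTemp} (hx : x ∈ D.DeltaTemp) :
    ∃ y ∈ D.DtpY, ∃ n : ℤ, x = y * z ^ n := by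
  refine ⟨x * (z ^ (Multiplicative.toAdd (D.toZ x)))⁻¹, ⟨?_, ?_⟩, Multiplicative.toAdd (D.toZ x), ?_⟩
  · change x * (z ^ (Multiplicative.toAdd (D.toZ x)))⁻¹ ∈ D.toZ.ker
    rw [MonoidHom.mem_ker, map_mul, map_inv, map_zpow, hzZ, ← ofAdd_zsmul, smul_eq_mul, mul_one,
      ofAdd_toAdd, mul_inv_cancel]
  · exact D.DeltaTemp.mul_mem hx (D.DeltaTemp.inv_mem (D.DeltaTemp.zpow_mem hz _))
  · rw [inv_mul_cancel_right]

/-- If `g` commutes modulo `N·(Δ^tp_Y)^ell` with every element of `Δ^tp_Y` and with a lift `z` of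
`1 ∈ Z`, then it commutes modulo `N·(Δ^tp_Y)^ell` with all of `Δ^tp_X`.
[cite: MochizukiEtTh2009, §1 p.13] -/
theorem actsTrivially_of_DtpY_of_generator (N : ℕ+) (g : D.PiTemp) {z : D.PiTemp}
    (hz : z ∈ D.DeltaTemp) (hzZ : D.toZ z = Multiplicative.ofAdd 1)
    (hY : ∀ y ∈ D.DtpY, toEll D (g * y * g⁻¹ * y⁻¹) ∈ ellPowersY D N)
    (hgz : toEll D (g * z * g⁻¹ * z⁻¹) ∈ ellPowersY D N) :
    ∀ x ∈ D.DeltaTemp, toEll D (g * x * g⁻¹ * x⁻¹) ∈ ellPowersY D N := by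
  -- the subgroup of `Δ^tp_X` on which `g` acts trivially modulo `N·(Δ^tp_Y)^ell`
  let S : Subgroup D.PiTemp :=
    { carrier := {x | x ∈ D.DeltaTemp ∧ toEll D (g * x * g⁻¹ * x⁻¹) ∈ ellPowersY D N}
      one_mem' := ⟨D.DeltaTemp.one_mem, by
        simp only [mul_one, inv_one, mul_inv_cancel, map_one]
        exact (ellPowersY D N).one_mem⟩
      mul_mem' := fun {a b} ha hb =>
        ⟨D.DeltaTemp.mul_mem ha.1 hb.1, actsTrivially_mul D N g ha.1 hb.1 ha.2 hb.2⟩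
      inv_mem' := fun {a} ha => ⟨D.DeltaTemp.inv_mem ha.1, actsTrivially_inv D N g ha.1 ha.2⟩ }
  have hzS : z ∈ S := ⟨hz, hgz⟩
  intro x hx
  obtain ⟨y, hy, n, rfl⟩ := exists_mem_DtpY_mul_zpow D hz hzZ hx
  have hyS : y ∈ S := ⟨hy.2, hY y hy⟩
  exact (S.mul_mem hyS (S.zpow_mem hzS n)).2

/-! ### `GKNIsKernelOfAction` from the Tate-module structure -/

/-- **«G_{K_N} acts trivially on (Δ^tp_X)^ell/N·(Δ^tp_Y)^ell» from the Tate-module structure.** For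
`y₁ ∈ Δ^tp_Y`, `z ∈ Δ^tp_X` with `toZ z = 1`, a primitive `N`-th root of unity `ζ` and an `N`-th root `r`
of `q_X` satisfying (a) the class of `y₁` has order exactly `N` modulo `N·(Δ^tp_Y)^ell`, (b) the Tate
twist `aug(g) ζ = ζ^k ⟹ (g y g⁻¹)^ell ≡ (y^ell)^k` on `Δ^tp_Y`, (c) the Kummer class of `q_X`:
`aug(g) r = ζ^m r ⟹ (g z g⁻¹ z⁻¹)^ell ≡ (y₁^ell)^m` — the characterisation `GKNIsKernelOfAction D N`
holds: `aug(g) ∈ G_{K_N}` iff `g` acts trivially on `(Δ^tp_X)^ell/N·(Δ^tp_Y)^ell`.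
[cite: MochizukiEtTh2009, §1 p.13] -/
theorem gknIsKernelOfAction_of_tate (N : ℕ+) {y₁ z : D.PiTemp} {ζ r : PadicAlgCl p}
    (hy₁ : y₁ ∈ D.DtpY) (hz : z ∈ D.DeltaTemp) (hzZ : D.toZ z = Multiplicative.ofAdd 1)
    (hζ : IsPrimitiveRoot ζ (N : ℕ)) (hr : r ^ (N : ℕ) = D.qX)
    (hord : ∀ k : ℕ, toEll D y₁ ^ k ∈ ellPowersY D N ↔ (N : ℕ) ∣ k)
    (htw : ∀ (g : D.PiTemp) (k : ℕ), D.aug g ζ = ζ ^ k → ∀ y ∈ D.DtpY,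
      toEll D (g * y * g⁻¹) * (toEll D y ^ k)⁻¹ ∈ ellPowersY D N)
    (hkum : ∀ (g : D.PiTemp) (m : ℕ), D.aug g r = ζ ^ m * r →
      toEll D (g * z * g⁻¹ * z⁻¹) * (toEll D y₁ ^ m)⁻¹ ∈ ellPowersY D N) :
    GKNIsKernelOfAction D N := by
  haveI : NeZero (N : ℕ) := ⟨N.ne_zero⟩
  have hr0 : r ≠ 0 := by
    intro h
    apply D.qX_ne_zero
    rw [← hr, h, zero_pow N.ne_zero]
  -- `aug(g)` fixes `K`, in particular `q_X`
  have hfixq : ∀ g : D.PiTemp, D.aug g D.qX = D.qX := by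
    intro g
    have hg : D.aug g ∈ D.K.fixingSubgroup := by
      rw [← D.range_aug]; exact ⟨g, rfl⟩
    rw [IntermediateField.mem_fixingSubgroup_iff] at hg
    exact hg D.qX D.qX_mem
  intro g
  rw [aug_mem_GKN_iff D N g]
  constructor
  · -- (→): `aug(g)` fixes `ζ` and `r`
    rintro ⟨hζfix, hrfix⟩
    have hζ1 : D.aug g ζ = ζ ^ 1 := by rw [pow_one]; exact hζfix ζ hζ.pow_eq_one
    have hr1 : D.aug g r = ζ ^ 0 * r := by rw [pow_zero, one_mul]; exact hrfix r hr
    refine actsTrivially_of_DtpY_of_generator D N g hz hzZ (fun y hy => ?_) ?_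
    · have h := htw g 1 hζ1 y hy
      rwa [pow_one, ← map_inv, ← map_mul] at h
    · have h := hkum g 0 hr1
      rwa [pow_zero, inv_one, mul_one] at h
  · -- (←): commuting modulo `N` with `y₁` and `z` pins `aug(g)` on `ζ` and `r`
    intro hact
    -- `aug(g) ζ = ζ^k`
    have hζN : (D.aug g ζ) ^ (N : ℕ) = 1 := by rw [← map_pow, hζ.pow_eq_one, map_one]
    obtain ⟨k, -, hk⟩ := hζ.eq_pow_of_pow_eq_one hζN
    -- `aug(g) r = ζ^m · r`
    have hrN : (D.aug g r * r⁻¹) ^ (N : ℕ) = 1 := by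
      rw [mul_pow, ← map_pow, hr, hfixq, inv_pow, hr, mul_inv_cancel₀ D.qX_ne_zero]
    obtain ⟨m, -, hm⟩ := hζ.eq_pow_of_pow_eq_one hrN
    have hm' : D.aug g r = ζ ^ m * r := by
      rw [hm, inv_mul_cancel_right₀ hr0]
    -- `ζ` is fixed: `y₁^{k}·y₁⁻¹ ∈ N·B` forces `ζ^k = ζ`
    have hy₁act : toEll D (g * y₁ * g⁻¹) * (toEll D y₁)⁻¹ ∈ ellPowersY D N := by
      have := hact y₁ hy₁.2
      rwa [map_mul, map_inv] at this
    have hy₁tw := htw g k hk.symm y₁ hy₁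
    have hdiff : toEll D y₁ ^ k * (toEll D y₁)⁻¹ ∈ ellPowersY D N := by
      have := (ellPowersY D N).mul_mem ((ellPowersY D N).inv_mem hy₁tw) hy₁act
      rwa [mul_inv_rev, inv_inv, mul_assoc, inv_mul_cancel_left] at this
    have hζfix : D.aug g ζ = ζ := by
      rcases Nat.eq_zero_or_pos k with rfl | hkpos
      · -- `k = 0`: then `y₁ ∈ N·B`, so `N = 1` and `ζ = 1`
        rw [pow_zero, one_mul] at hdiff
        have h1 : toEll D y₁ ^ 1 ∈ ellPowersY D N := by
          rw [pow_one]; exact (ellPowersY D N).inv_mem_iff.mp hdiff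
        have hN1 : (N : ℕ) = 1 := Nat.dvd_one.mp ((hord 1).mp h1)
        have hζ1 : ζ = 1 := by
          have := hζ; rw [hN1] at this; exact IsPrimitiveRoot.one_right_iff.mp this
        rw [hζ1, map_one]
      · have hsub : toEll D y₁ ^ k * (toEll D y₁)⁻¹ = toEll D y₁ ^ (k - 1) := by
          rw [← pow_sub_one_mul (Nat.pos_iff_ne_zero.mp hkpos), mul_inv_cancel_right]
        rw [hsub, hord] at hdiff
        rw [← hk]
        obtain ⟨c, hc⟩ := hdiff
        calc ζ ^ k = ζ ^ (k - 1) * ζ := by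
              rw [← pow_succ, Nat.sub_add_cancel hkpos]
          _ = ζ := by rw [hc, pow_mul, hζ.pow_eq_one, one_pow, one_mul]
    -- `r` is fixed: `y₁^m ∈ N·B` forces `ζ^m = 1`
    have hzact : toEll D (g * z * g⁻¹ * z⁻¹) ∈ ellPowersY D N := hact z hz
    have hm0 : toEll D y₁ ^ m ∈ ellPowersY D N := by
      have := (ellPowersY D N).mul_mem ((ellPowersY D N).inv_mem (hkum g m hm')) hzact
      rwa [mul_inv_rev, inv_inv, mul_assoc, inv_mul_cancel, mul_one] at this
    have hζm : ζ ^ m = 1 := (hζ.pow_eq_one_iff_dvd m).mpr ((hord m).mp hm0)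
    have hrfix : D.aug g r = r := by rw [hm', hζm, one_mul]
    refine ⟨fun ξ hξ => ?_, fun r' hr' => ?_⟩
    · obtain ⟨i, -, rfl⟩ := hζ.eq_pow_of_pow_eq_one hξ
      rw [map_pow, hζfix]
    · have hq : (r' * r⁻¹) ^ (N : ℕ) = 1 := by
        rw [mul_pow, hr', inv_pow, hr, mul_inv_cancel₀ D.qX_ne_zero]
      obtain ⟨i, -, hi⟩ := hζ.eq_pow_of_pow_eq_one hq
      have hr'' : r' = ζ ^ i * r := by rw [hi, inv_mul_cancel_right₀ hr0]
      rw [hr'', map_mul, map_pow, hζfix, hrfix]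

/-- **Bundled form**, taking VERBATIM the conjunction of the clause `tate` of the origin predicate
`ThetaSetting.IsThm16Origin` (abc-iut-L2-t6; clause drafted by abc-iut-w5-d051): the p. 13
characterisation holds at every `N`. (The generation clause (a₁) "every `y ∈ Δ^tp_Y` is `≡ y₁^k`" is
carried but not needed for this corollary.) [cite: MochizukiEtTh2009, §1 p.13] -/
theorem gknIsKernelOfAction_of_tateClause
    (htate : ∀ N : ℕ+, ∃ (y₁ z : D.PiTemp) (ζ r : PadicAlgCl p),
      y₁ ∈ D.DtpY ∧ z ∈ D.DeltaTemp ∧ D.toZ z = Multiplicative.ofAdd 1 ∧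
      IsPrimitiveRoot ζ (N : ℕ) ∧ r ^ (N : ℕ) = D.qX ∧
      (∀ y ∈ D.DtpY, ∃ k : ℕ, toEll D y * (toEll D y₁ ^ k)⁻¹ ∈ ellPowersY D N) ∧
      (∀ k : ℕ, toEll D y₁ ^ k ∈ ellPowersY D N ↔ (N : ℕ) ∣ k) ∧
      (∀ (g : D.PiTemp) (k : ℕ), D.aug g ζ = ζ ^ k → ∀ y ∈ D.DtpY,
        toEll D (g * y * g⁻¹) * (toEll D y ^ k)⁻¹ ∈ ellPowersY D N) ∧
      (∀ (g : D.PiTemp) (m : ℕ), D.aug g r = ζ ^ m * r →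
        toEll D (g * z * g⁻¹ * z⁻¹) * (toEll D y₁ ^ m)⁻¹ ∈ ellPowersY D N))
    (N : ℕ+) : GKNIsKernelOfAction D N := by
  obtain ⟨y₁, z, ζ, r, hy₁, hz, hzZ, hζ, hr, -, hord, htw, hkum⟩ := htate N
  exact gknIsKernelOfAction_of_tate D N hy₁ hz hzZ hζ hr hord htw hkum

end Thm16Sub

end Literature.AnabelianGeometry.EtaleTheta

end
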